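import Mathlib
import HarnessLib
import Summits.CriticalPhenomena.PercolationContinuityZ3.Theses.PercPotemkinWeaver

/-!
# Rung R-G for `DenseGiantHalfSpace` (X₂, stmt-CriticalPhenomena-18903) — majority pieces with a
summable rate force an infinite half-space piece, for EVERY probability measure

BC5 witness of weakness proposed by the redirect strategist r1 (2026-08-17): the `δ > 1/2` sector
of X₂ with a Borel–Cantelli rate needs no independence, no association, no ergodicity:
consecutive majority pieces of the nested boxes `B'_n = Λ_n + n·e₀ ⊂ {0 ≤ x₀}` share a vertex
(pigeonhole), so they all lie in ONE cluster of the half-space `{0 ≤ x₀}`, which is then infinite.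
What the rung leaves open is exactly X₂'s content: `δ ≤ 1/2` (gluing of dense pieces) and the
rate-free `→ 1` hypothesis (coarse-graining without independence).
-/

namespace Summit.CriticalPhenomena.PercolationContinuityZ3.Cruxes.DenseGiantHalfSpace.Rung

open MeasureTheory Filter
open Literature.Probability.Percolation Literature.Probability.LatticeModels
open Summit.CriticalPhenomena.PercolationContinuityZ3.Theses.PercPotemkinWeaver (DenseGiantHalfSpace)

/-! ## Elementary facts on `openConnIn` (reproved locally to keep the imports minimal) -/

section OpenConnIn
variable {V : Type*} {S S' : Set V} {x y z : V} {ω : BondConfig V}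

theorem occ_mono (h : S ⊆ S') (hω : ω ∈ openConnIn S x y) : ω ∈ openConnIn S' x y := by
  obtain ⟨hx, hy, hr⟩ := hω
  exact ⟨h hx, h hy, hr.map (SimpleGraph.induceHomOfLE (G := openGraph ω) h).toHom⟩

theorem occ_symm (hω : ω ∈ openConnIn S x y) : ω ∈ openConnIn S y x := by
  obtain ⟨hx, hy, hr⟩ := hω
  exact ⟨hy, hx, hr.symm⟩

theorem occ_trans (h₁ : ω ∈ openConnIn S x y) (h₂ : ω ∈ openConnIn S y z) :
    ω ∈ openConnIn S x z := by
  obtain ⟨hx, hy, hr⟩ := h₁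
  obtain ⟨hy', hz, hr'⟩ := h₂
  exact ⟨hx, hz, hr.trans hr'⟩

theorem occ_refl (hx : x ∈ S) : ω ∈ openConnIn S x x :=
  ⟨hx, hx, SimpleGraph.Reachable.refl _⟩

theorem mem_right_of_occ (hω : ω ∈ openConnIn S x y) : y ∈ S := by
  obtain ⟨_, hy, _⟩ := hω
  exact hy

end OpenConnIn

/-! ## The boxes `B'_n` inside the half-space `H = {0 ≤ x₀}` -/

/-- The shifted box `B'_n = Λ_n + n·e₀ = [0,2n] × [-n,n]²`, inside the half-space `{0 ≤ x₀}`. -/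
noncomputable def hsBox (n : ℕ) : Finset (Site 3) :=
  (box 3 n).image (fun x => x + Pi.single (0 : Fin 3) (n : ℤ))

/-- The half-space `H = {0 ≤ x₀}` (the `i = 0, a = 0` member of X₂'s family `{a ≤ x_i}`). -/
def H : Set (Site 3) := {x : Site 3 | (0 : ℤ) ≤ x 0}

theorem mem_hsBox {n : ℕ} {x : Site 3} :
    x ∈ hsBox n ↔ ∀ i, -(n : ℤ) ≤ x i - (Pi.single (0 : Fin 3) (n : ℤ) : Site 3) i ∧
      x i - (Pi.single (0 : Fin 3) (n : ℤ) : Site 3) i ≤ n := by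
  simp only [hsBox, Finset.mem_image, mem_box]
  constructor
  · rintro ⟨y, hy, rfl⟩ i
    simpa using hy i
  · intro h
    exact ⟨x - (Pi.single (0 : Fin 3) (n : ℤ) : Site 3), fun i => by simpa using h i, by simp⟩

theorem card_hsBox (n : ℕ) : (hsBox n).card = (2 * n + 1) ^ 3 := by
  rw [hsBox, Finset.card_image_of_injective _ (add_left_injective _), card_box]

theorem hsBox_subset_H (n : ℕ) : (↑(hsBox n) : Set (Site 3)) ⊆ H := by
  intro x hx
  have h0 := ((mem_hsBox.mp (Finset.mem_coe.mp hx)) 0).1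
  simp only [Pi.single_eq_same] at h0
  show (0 : ℤ) ≤ x 0
  linarith

theorem hsBox_subset_succ (n : ℕ) : hsBox n ⊆ hsBox (n + 1) := by
  intro x hx
  rw [mem_hsBox] at hx ⊢
  intro i
  have hi := hx i
  by_cases h0 : i = 0
  · subst h0
    simp only [Pi.single_eq_same] at hi ⊢
    push_cast
    constructor <;> linarith [hi.1, hi.2]
  · simp only [Pi.single_eq_of_ne h0, sub_zero] at hi ⊢
    push_cast
    constructor <;> linarith [hi.1, hi.2]

/-! ## The pieces -/

/-- The open box-piece of `x` in `B'_n`: vertices joined to `x` by an open path inside `B'_n`. -/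
def piece (n : ℕ) (x : Site 3) (ω : BondConfig (Site 3)) : Set (Site 3) :=
  {y | ω ∈ openConnIn (↑(hsBox n) : Set (Site 3)) x y}

theorem piece_subset (n : ℕ) (x : Site 3) (ω : BondConfig (Site 3)) :
    piece n x ω ⊆ ↑(hsBox n) := fun _ hy => mem_right_of_occ hy

/-- The "bad" event at scale `n`: no `(1/2+γ)`-dense box-piece in `B'_n`. -/
def bad (γ : ℝ) (n : ℕ) : Set (BondConfig (Site 3)) :=
  {ω | ∀ x ∈ hsBox n, ((piece n x ω).ncard : ℝ) < (1 / 2 + γ) * ((hsBox n).card : ℝ)}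

/-! ## Arithmetic of consecutive boxes -/

theorem cube_succ_le {γ : ℝ} (hγ : 0 < γ) {n : ℕ} (hn : 13 / γ ≤ n) :
    ((2 * ((n : ℝ) + 1) + 1)) ^ 3 ≤ (1 + 2 * γ) * (2 * (n : ℝ) + 1) ^ 3 := by
  have hn0 : (0 : ℝ) ≤ n := Nat.cast_nonneg n
  have h13 : 13 ≤ γ * n := by
    have := (div_le_iff₀ hγ).mp hn
    linarith [this]
  set m : ℝ := 2 * (n : ℝ) + 1 with hm
  have hm1 : 1 ≤ m := by rw [hm]; linarith
  have hmn : (n : ℝ) ≤ m := by rw [hm]; linarith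
  have hγm : 13 ≤ γ * m := le_trans h13 (mul_le_mul_of_nonneg_left hmn hγ.le)
  have hexp : (2 * ((n : ℝ) + 1) + 1) = m + 2 := by rw [hm]; ring
  rw [hexp]
  have hm0 : 0 ≤ m := le_trans zero_le_one hm1
  have hmm : 0 ≤ m * m := mul_nonneg hm0 hm0
  -- (m+2)^3 = m^3 + 6m^2 + 12m + 8 ≤ m^3 + 26 m^2 ≤ m^3 + 2γ m^3
  have h1 : 12 * m ≤ 12 * (m * m) := by nlinarith
  have h2 : (8 : ℝ) ≤ 8 * (m * m) := by nlinarith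
  have h3 : 26 * (m * m) ≤ 2 * γ * (m * m * m) := by
    have h26 : (26 : ℝ) ≤ 2 * (γ * m) := by linarith
    have := mul_le_mul_of_nonneg_left h26 hmm
    nlinarith [this]
  nlinarith [h1, h2, h3]

/-- **Pigeonhole.** A `(1/2+γ)`-dense subset of `B'_n` and a `(1/2+γ)`-dense subset of `B'_{n+1}`
intersect, once `n ≥ 13/γ`. -/
theorem inter_nonempty_of_dense {γ : ℝ} (hγ : 0 < γ) {n : ℕ} (hn : 13 / γ ≤ n)
    {A P : Set (Site 3)} (hA : A ⊆ ↑(hsBox n)) (hP : P ⊆ ↑(hsBox (n + 1)))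
    (hAd : (1 / 2 + γ) * ((hsBox n).card : ℝ) ≤ (A.ncard : ℝ))
    (hPd : (1 / 2 + γ) * ((hsBox (n + 1)).card : ℝ) ≤ (P.ncard : ℝ)) : (A ∩ P).Nonempty := by
  by_contra hne
  rw [Set.not_nonempty_iff_eq_empty] at hne
  have hAfin : A.Finite := (hsBox n).finite_toSet.subset hA
  have hPfin : P.Finite := (hsBox (n + 1)).finite_toSet.subset hP
  set Bn : Set (Site 3) := ↑(hsBox n) with hBn
  set Bn1 : Set (Site 3) := ↑(hsBox (n + 1)) with hBn1
  have hsub : Bn ⊆ Bn1 := by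
    rw [hBn, hBn1]; exact Finset.coe_subset.mpr (hsBox_subset_succ n)
  have hBnc : Bn.ncard = (hsBox n).card := by rw [hBn, Set.ncard_coe_finset]
  have hBn1c : Bn1.ncard = (hsBox (n + 1)).card := by rw [hBn1, Set.ncard_coe_finset]
  -- |P| = |P ∩ Bn| + |P \ Bn| and |P \ Bn| ≤ |Bn1| - |Bn|
  have hsplit : (P ∩ Bn).ncard + (P \ Bn).ncard = P.ncard :=
    Set.ncard_inter_add_ncard_sdiff_eq_ncard P Bn hPfin
  have hdiff : (P \ Bn).ncard ≤ (Bn1 \ Bn).ncard :=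
    Set.ncard_le_ncard (Set.sdiff_subset_sdiff_left hP) ((hsBox (n + 1)).finite_toSet.sdiff)
  have hdiff' : (Bn1 \ Bn).ncard = Bn1.ncard - Bn.ncard := Set.ncard_sdiff hsub
  have hle : Bn.ncard ≤ Bn1.ncard := Set.ncard_le_ncard hsub (hsBox (n + 1)).finite_toSet
  -- disjointness: |A| + |P ∩ Bn| ≤ |Bn|
  have hdisj : Disjoint A (P ∩ Bn) := by
    rw [Set.disjoint_iff_inter_eq_empty, ← Set.inter_assoc, hne, Set.empty_inter]
  have hunion : (A ∪ (P ∩ Bn)).ncard = A.ncard + (P ∩ Bn).ncard :=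
    Set.ncard_union_eq hdisj hAfin (hPfin.inter_of_left Bn)
  have hunion_le : (A ∪ (P ∩ Bn)).ncard ≤ Bn.ncard :=
    Set.ncard_le_ncard (Set.union_subset hA Set.inter_subset_right) (hsBox n).finite_toSet
  -- in naturals: A + P + |Bn| ≤ |Bn| + |Bn1|, i.e. A + P ≤ |Bn1|
  have hnat : A.ncard + P.ncard ≤ (hsBox (n + 1)).card := by
    rw [← hBn1c]; omega
  -- pass to reals
  have hreal : (A.ncard : ℝ) + (P.ncard : ℝ) ≤ ((hsBox (n + 1)).card : ℝ) := by exact_mod_cast hnat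
  have ha : ((hsBox n).card : ℝ) = (2 * (n : ℝ) + 1) ^ 3 := by
    rw [card_hsBox]; push_cast; ring
  have hb : ((hsBox (n + 1)).card : ℝ) = (2 * ((n : ℝ) + 1) + 1) ^ 3 := by
    rw [card_hsBox]; push_cast; ring
  have hcube := cube_succ_le hγ hn
  rw [← ha, ← hb] at hcube
  have hapos : (1 : ℝ) ≤ ((hsBox n).card : ℝ) := by
    rw [ha]; nlinarith [Nat.cast_nonneg (α := ℝ) n]
  have hb0 : (0 : ℝ) ≤ ((hsBox (n + 1)).card : ℝ) := Nat.cast_nonneg _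
  -- (1/2+γ) a + (1/2+γ) b ≤ b and b ≤ (1+2γ) a contradict a ≥ 1, γ > 0
  have hkey : (1 / 2 + γ) * ((hsBox n).card : ℝ) + (1 / 2 + γ) * ((hsBox (n + 1)).card : ℝ)
      ≤ ((hsBox (n + 1)).card : ℝ) := by linarith
  have hprod : 0 ≤ γ * (((hsBox n).card : ℝ) - 1) := mul_nonneg hγ.le (by linarith)
  by_cases hγ2 : γ < 1 / 2
  · have h1 := mul_le_mul_of_nonneg_left hcube (show (0 : ℝ) ≤ 1 / 2 - γ by linarith)
    have hprod2 : 0 ≤ (γ + 2 * γ ^ 2) * (((hsBox n).card : ℝ) - 1) :=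
      mul_nonneg (by positivity) (by linarith)
    nlinarith [h1, hkey, hprod, hprod2, sq_nonneg γ, hγ, hapos]
  · have hγ2' : 1 / 2 ≤ γ := not_lt.mp hγ2
    have h2 : 0 ≤ ((hsBox (n + 1)).card : ℝ) * (γ - 1 / 2) := mul_nonneg hb0 (by linarith)
    nlinarith [hkey, h2, hprod, hapos, hγ]

/-! ## The deterministic core: eventually-good configurations have an infinite half-space piece -/

theorem not_all_finite_of_eventually_good {γ : ℝ} (hγ : 0 < γ) (ω : BondConfig (Site 3))
    (hω : ∀ᶠ n in atTop, ω ∉ bad γ n)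
    (hfin : ∀ v : Site 3, {y : Site 3 | ω ∈ openConnIn H v y}.Finite) : False := by
  obtain ⟨N, hN⟩ := Filter.eventually_atTop.mp hω
  -- good scales: a dense piece exists
  have hgood : ∀ n, N ≤ n → ∃ x, x ∈ hsBox n ∧
      (1 / 2 + γ) * ((hsBox n).card : ℝ) ≤ ((piece n x ω).ncard : ℝ) := by
    intro n hn
    have h := hN n hn
    simp only [bad, Set.mem_setOf_eq, not_forall, not_lt] at h
    obtain ⟨x, hx, hd⟩ := h
    exact ⟨x, hx, hd⟩
  choose! x hxmem hxd using hgood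
  -- threshold for the pigeonhole
  set N₁ : ℕ := max N ⌈13 / γ⌉₊ with hN₁
  have hN₁N : N ≤ N₁ := le_max_left _ _
  have hN₁γ : ∀ n, N₁ ≤ n → 13 / γ ≤ (n : ℝ) := by
    intro n hn
    have h1 : (⌈13 / γ⌉₊ : ℝ) ≤ n := by exact_mod_cast le_trans (le_max_right N _) hn
    exact le_trans (Nat.le_ceil _) h1
  -- consecutive pieces intersect
  have hinter : ∀ n, N₁ ≤ n → (piece n (x n) ω ∩ piece (n + 1) (x (n + 1)) ω).Nonempty := by
    intro n hn
    exact inter_nonempty_of_dense hγ (hN₁γ n hn) (piece_subset _ _ _) (piece_subset _ _ _)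
      (hxd n (le_trans hN₁N hn)) (hxd (n + 1) (le_trans hN₁N (Nat.le_succ_of_le hn)))
  -- all anchors x n, n ≥ N₁, are joined inside H to v := x N₁
  have hvH : x N₁ ∈ H := hsBox_subset_H N₁ (Finset.mem_coe.mpr (hxmem N₁ hN₁N))
  have hchain : ∀ n, N₁ ≤ n → ω ∈ openConnIn H (x N₁) (x n) := by
    intro n hn
    induction n, hn using Nat.le_induction with
    | base => exact occ_refl hvH
    | succ k hk ih =>
      obtain ⟨z, hz1, hz2⟩ := hinter k hk
      have h1 : ω ∈ openConnIn H (x k) z := occ_mono (hsBox_subset_H k) hz1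
      have h2 : ω ∈ openConnIn H (x (k + 1)) z := occ_mono (hsBox_subset_H (k + 1)) hz2
      exact occ_trans (occ_trans ih h1) (occ_symm h2)
  -- hence the H-piece of x N₁ contains every piece n (x n), n ≥ N₁
  have hCsup : ∀ n, N₁ ≤ n → piece n (x n) ω ⊆ {y : Site 3 | ω ∈ openConnIn H (x N₁) y} := by
    intro n hn y hy
    exact occ_trans (hchain n hn) (occ_mono (hsBox_subset_H n) hy)
  have hCfin : {y : Site 3 | ω ∈ openConnIn H (x N₁) y}.Finite := hfin (x N₁)
  -- but the pieces have unbounded size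
  set M : ℕ := {y : Site 3 | ω ∈ openConnIn H (x N₁) y}.ncard with hM
  set n₀ : ℕ := max N₁ M with hn₀
  have hn₀N : N₁ ≤ n₀ := le_max_left _ _
  have hle : (piece n₀ (x n₀) ω).ncard ≤ M := Set.ncard_le_ncard (hCsup n₀ hn₀N) hCfin
  have hle' : ((piece n₀ (x n₀) ω).ncard : ℝ) ≤ (M : ℝ) := by exact_mod_cast hle
  have hd := hxd n₀ (le_trans hN₁N hn₀N)
  have hcard : ((hsBox n₀).card : ℝ) = (2 * (n₀ : ℝ) + 1) ^ 3 := by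
    rw [card_hsBox]; push_cast; ring
  have hMn : (M : ℝ) ≤ n₀ := by exact_mod_cast le_max_right N₁ M
  have hn0 : (0 : ℝ) ≤ n₀ := Nat.cast_nonneg _
  rw [hcard] at hd
  -- (1/2+γ)(2n₀+1)^3 ≥ (1/2)(2n₀+1) > n₀ ≥ M ≥ |piece| ≥ (1/2+γ)(2n₀+1)^3 : absurd
  have h1 : (1 : ℝ) ≤ 2 * (n₀ : ℝ) + 1 := by linarith
  have hpow : (2 * (n₀ : ℝ) + 1) ≤ (2 * (n₀ : ℝ) + 1) ^ 3 := by
    have := pow_le_pow_right₀ h1 (show 1 ≤ 3 by norm_num)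
    simpa using this
  have hγt : 0 < γ * (2 * (n₀ : ℝ) + 1) ^ 3 := mul_pos hγ (by positivity)
  nlinarith [hd, hle', hMn, hn0, hγ, hpow, hγt]

/-! ## The rung -/

/-- **Rung R-G.** For every probability measure on bond configurations of `ℤ³`: if for some
`γ > 0` the bad events (no `(1/2+γ)`-dense box-piece in `B'_n`) have summable probabilities, then it
is NOT the case that a.s. every cluster of every coordinate half-space is finite. -/
def MajorityRateHalfSpace : Prop :=
  ∀ μ : Measure (BondConfig (Site 3)), IsProbabilityMeasure μ →
    (∃ γ : ℝ, 0 < γ ∧ (∑' n : ℕ, μ (bad γ n)) ≠ ⊤) →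
    ¬ (∀ᵐ ω ∂μ, ∀ (i : Fin 3) (a : ℤ) (v : Site 3),
        {y : Site 3 | ω ∈ openConnIn {x : Site 3 | a ≤ x i} v y}.Finite ∧
        {y : Site 3 | ω ∈ openConnIn {x : Site 3 | x i ≤ a} v y}.Finite)

theorem majorityRateHalfSpace : MajorityRateHalfSpace := by
  intro μ hμ hrate hfin
  obtain ⟨γ, hγ, hsum⟩ := hrate
  have hBC : ∀ᵐ ω ∂μ, ∀ᶠ n in atTop, ω ∉ bad γ n := MeasureTheory.ae_eventually_notMem hsum
  have hfalse : ∀ᵐ ω ∂μ, False := by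
    filter_upwards [hBC, hfin] with ω hω hω'
    refine not_all_finite_of_eventually_good hγ ω hω (fun v => ?_)
    have h := (hω' 0 0 v).1
    simpa [H] using h
  simp only [Filter.eventually_false_iff_eq_bot, MeasureTheory.ae_eq_bot] at hfalse
  exact (IsProbabilityMeasure.ne_zero μ) hfalse

/-- **R-G is a special case of X₂'s shape.** For any measure, X₂'s conclusion `¬HSfin` already
follows from the rate hypothesis alone; in particular it follows under X₂'s thirteen hypotheses
plus the rate (for a shift-invariant `μ` — X₂'s third hypothesis — the rate hypothesis is X₂'s
monolithicity with `δ = 1/2 + γ` on the translated boxes `Λ_n + n·e₀`, sharpened from `→ 1` to a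
summable failure probability). -/
theorem denseGiantHalfSpace_rateSector
    (μ : Measure (BondConfig (Site 3))) [IsProbabilityMeasure μ]
    (hrate : ∃ γ : ℝ, 0 < γ ∧ (∑' n : ℕ, μ (bad γ n)) ≠ ⊤) :
    ¬ (∀ᵐ ω ∂μ, ∀ (i : Fin 3) (a : ℤ) (v : Site 3),
        {y : Site 3 | ω ∈ openConnIn {x : Site 3 | a ≤ x i} v y}.Finite ∧
        {y : Site 3 | ω ∈ openConnIn {x : Site 3 | x i ≤ a} v y}.Finite) :=
  majorityRateHalfSpace μ inferInstance hrate

end Summit.CriticalPhenomena.PercolationContinuityZ3.Cruxes.DenseGiantHalfSpace.Rung
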